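import Literature.GroupTheory.SpecificGroups.SL2OddPrimeStableCharacterExtension
import Mathlib.Algebra.CharP.Two
import HarnessLib

/-!
# EXT-CRIT for `SL₂(𝔽_q)`, `q` odd prime — proved consumer forms of the named fact
# `sl2ZModOddPrime_existsUnique_extension_of_stable_character`

Theorem-only sibling of `SL2OddPrimeStableCharacterExtension.lean` (the statement-only named fact, a derived reading
of Fiedorowicz–Priddy 1978 Ch. VI Prop. 5.4 `H¹ = H² = 0` for `SL₂(𝔽_q)` mod `2`, `q` odd, via the Hochschild–Serre
five-term sequence, Brown GTM 87 VII (6.3)–(6.4)). Here: the PLAIN-FUNCTION, characteristic-`2`-field form in which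
the cell `bsd-f2-manin` line prover consumes it (seat bsd-line-manin23-p3, 2026-08-28T05:09:22Z spelling
`CharTwoExtensionOfSL2Quotient t`, endorsed by planner es 05:09:40Z): the character is a function `φ : G → K` whose
values off `ker π` are irrelevant, additivity and `G`-invariance are asked on `ker π` only, `K` is a field of
characteristic `2`, and only existence is returned (uniqueness is free: `Hom(SL₂(𝔽_q), (K,+)) = 0`). Nothing new is
assumed; the proof is the three-line adapter (restrict `φ` to the subtype `ker π`, `y + y = 0` from `CharP K 2`,
`g ↦ g⁻¹` in the stability clause).
-/

open scoped MatrixGroups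

namespace Literature.GroupTheory.SpecificGroups

/-- **EXT-CRIT, consumer form** (from the named fact `sl2ZModOddPrime_existsUnique_extension_of_stable_character`;
body = cell bsd-f2-manin p3's `CharTwoExtensionOfSL2Quotient t` VERBATIM after `(hF) (t) :`). For an odd prime `t`,
a group `G` with a surjection `π : G →* SL(2, ZMod t)`, a field `K` of characteristic `2`, and a function
`φ : G → K` additive on `ker π` and invariant under `n ↦ g n g⁻¹` there: some additive `Φ : G → K` agrees with `φ` on
`ker π`. [cite: FiedorowiczPriddy1978, Ch. VI Prop. 5.4; Brown1982CohomologyGroups, VII (6.3)-(6.4) (derived reading, see `SL2OddPrimeStableCharacterExtension`)] -/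
theorem exists_additive_extension_of_sl2ZModOddPrime_quotient_charTwo
    (hF : sl2ZModOddPrime_existsUnique_extension_of_stable_character) (t : ℕ) :
    t.Prime → t ≠ 2 → ∀ (G : Type) [Group G] (K : Type) [Field K] [CharP K 2] (π : G →* SL(2, ZMod t)),
      Function.Surjective π → ∀ φ : G → K, (∀ n ∈ π.ker, ∀ n' ∈ π.ker, φ (n * n') = φ n + φ n') →
      (∀ g : G, ∀ n ∈ π.ker, φ (g * n * g⁻¹) = φ n) →
      ∃ Φ : G → K, (∀ g g' : G, Φ (g * g') = Φ g + Φ g') ∧ ∀ n ∈ π.ker, Φ n = φ n := by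
  intro ht ht2 G _ K _ _ π hπ φ hadd hinv
  have h2 : ∀ y : K, y + y = 0 := fun y => CharTwo.add_self_eq_zero y
  obtain ⟨Ψ, ⟨hΨadd, hΨres⟩, -⟩ := hF t ht ht2 G π hπ K h2 (fun a => φ a)
    (fun a b => hadd a a.2 b b.2)
    (fun g a ha => by
      have := hinv g⁻¹ a a.2
      simpa using this)
  exact ⟨Ψ, hΨadd, fun n hn => hΨres ⟨n, hn⟩⟩

/-- **EXT-CRIT, consumer form with uniqueness**: under the same hypotheses the additive extension is unique.
[cite: FiedorowiczPriddy1978, Ch. VI Prop. 5.4; Brown1982CohomologyGroups, VII (6.3)-(6.4), III.1 Ex. 2 (derived reading, see `SL2OddPrimeStableCharacterExtension`)] -/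
theorem existsUnique_additive_extension_of_sl2ZModOddPrime_quotient_charTwo
    (hF : sl2ZModOddPrime_existsUnique_extension_of_stable_character) (t : ℕ) :
    t.Prime → t ≠ 2 → ∀ (G : Type) [Group G] (K : Type) [Field K] [CharP K 2] (π : G →* SL(2, ZMod t)),
      Function.Surjective π → ∀ φ : G → K, (∀ n ∈ π.ker, ∀ n' ∈ π.ker, φ (n * n') = φ n + φ n') →
      (∀ g : G, ∀ n ∈ π.ker, φ (g * n * g⁻¹) = φ n) →
      ∃! Φ : G → K, (∀ g g' : G, Φ (g * g') = Φ g + Φ g') ∧ ∀ n ∈ π.ker, Φ n = φ n := by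
  intro ht ht2 G _ K _ _ π hπ φ hadd hinv
  have h2 : ∀ y : K, y + y = 0 := fun y => CharTwo.add_self_eq_zero y
  obtain ⟨Ψ, ⟨hΨadd, hΨres⟩, huniq⟩ := hF t ht ht2 G π hπ K h2 (fun a => φ a)
    (fun a b => hadd a a.2 b b.2)
    (fun g a ha => by
      have := hinv g⁻¹ a a.2
      simpa using this)
  refine ⟨Ψ, ⟨hΨadd, fun n hn => hΨres ⟨n, hn⟩⟩, ?_⟩
  rintro Ψ' ⟨hΨ'add, hΨ'res⟩
  exact huniq Ψ' ⟨hΨ'add, fun a => hΨ'res a a.2⟩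

end Literature.GroupTheory.SpecificGroups
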